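import Literature.NumberTheory.EllipticCurves.SupersingularIrreducibleProofs
import Literature.NumberTheory.EllipticCurves.Rank1Residual.EisensteinGoodComplement
import HarnessLib

/-!
# The "anomalous" dictionary at EVERY prime above `p` (any decomposition group at `p`)

`Proofs`-style file (THEOREMS ONLY), topic `NumberTheory/EllipticCurves`, cell `b2b-bsdres`
(run/shared/lean/b2b/bsd-rank1-residual/), HONEST FRAMING: the cell deletes the COMBINATION-SHAPED
residual classes of the rank-`≤ 1` BSD formula from PUBLISHED theorems only and types the rest; this
is not "finishing BSD".

`AnomalousDictionaryProofs` / `SupersingularIrreducibleProofs` prove, at the prime `𝔓` of `\bar ℤ`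
cut out by the tree's chosen place `placeOver p`, that for a good prime `p > 2` and the kernel `Φ` of
a rational `p`-isogeny: `a_p ≡ 1 (mod p)` iff the decomposition group `D_𝔓` fixes `Φ` pointwise or
acts trivially on `E[p]/Φ`. Castella–Grossi–Skinner 2025 say "`G_p ⊂ G_ℚ` is **a** decomposition
group at `p`": this file transports the statement to EVERY prime `𝔓'` of `\bar ℤ` above `p` (the
primes above `p` are `Γ_ℚ`-conjugate, `exists_smul_eq_of_mem_primesAbove_holds`; `D_{g𝔓} = g D_𝔓 g⁻¹`;
a rational line is `Γ_ℚ`-stable, so both clauses are conjugation-invariant):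

* `forall_decomposition_fix_of_smul_eq`, `forall_decomposition_quot_of_smul_eq` — transport along
  `g • 𝔓 = 𝔓'`;
* `anom_iff_decomposition_of_mem_primesAbove`, `not_anom_iff_cgs_of_mem_primesAbove`,
  `bsdp_of_thmD_of_cgs_of_mem_primesAbove` — the dictionary, CGS's literal hypothesis, and CGS 2025
  Thm. D with its printed hypothesis ⇒ `BSD(E,p)`, for any `𝔓' ∣ p`.

References: [Serre1972] §1.11; [CastellaGrossiSkinner2025] Thm. A/D, §0 p. 3; [NeukirchANT1999]
Ch. I §9 (9.4) (conjugate primes, conjugate decomposition groups).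
-/

set_option autoImplicit false

noncomputable section

open scoped Classical NumberField Pointwise

open WeierstrassCurve Literature.NumberTheory.EllipticCurves Literature.NumberTheory.GaloisRepresentations
  Field IsDedekindDomain NumberField Rat.HeightOneSpectrum

namespace Literature.NumberTheory.EllipticCurves.Rank1Residual

variable {W : WeierstrassCurve ℚ} [W.IsElliptic] [W.IsGloballyMinimal] {p : ℕ} [Fact p.Prime]

set_option synthInstance.maxHeartbeats 100000 in
omit [W.IsElliptic] [W.IsGloballyMinimal] [Fact p.Prime] in
/-- Conjugating into a decomposition group: if `g • 𝔓 = 𝔓'` and `h ∈ D_𝔓` then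
`g h g⁻¹ ∈ D_{𝔓'}`. Neukirch, ANT I (9.4). [folklore] -/
theorem conj_mem_decompositionSubgroup_of_smul_eq {𝔓 𝔓' : Ideal (absIntegers (𝓞 ℚ) ℚ)}
    {g : absoluteGaloisGroup ℚ} (hg : g • 𝔓 = 𝔓') {h : absoluteGaloisGroup ℚ}
    (hh : h ∈ 𝔓.decompositionSubgroup (absoluteGaloisGroup ℚ)) :
    g * h * g⁻¹ ∈ 𝔓'.decompositionSubgroup (absoluteGaloisGroup ℚ) := by
  rw [Ideal.decompositionSubgroup, MulAction.mem_stabilizer_iff] at hh ⊢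
  rw [← hg, mul_smul, mul_smul, inv_smul_smul, hh]

set_option synthInstance.maxHeartbeats 100000 in
omit [W.IsElliptic] [W.IsGloballyMinimal] in
/-- **Transport of "`D` fixes `Φ` pointwise"** along `g • 𝔓 = 𝔓'`, for a rational line `Φ`
(`Γ_ℚ`-stable): if `D_{𝔓'}` fixes `Φ` then so does `D_𝔓`. [folklore] -/
theorem forall_decomposition_fix_of_smul_eq {𝔓 𝔓' : Ideal (absIntegers (𝓞 ℚ) ℚ)}
    {g : absoluteGaloisGroup ℚ} (hg : g • 𝔓 = 𝔓') {Φ : AddSubgroup (geomTorsion W (p : ℤ))}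
    (hΦ : IsRationalLine W p Φ)
    (H : ∀ h ∈ 𝔓'.decompositionSubgroup (absoluteGaloisGroup ℚ), ∀ P ∈ Φ, h • P = P) :
    ∀ h ∈ 𝔓.decompositionSubgroup (absoluteGaloisGroup ℚ), ∀ P ∈ Φ, h • P = P := by
  intro h hh P hP
  have h1 := H _ (conj_mem_decompositionSubgroup_of_smul_eq hg hh) (g • P) (hΦ.2 g P hP)
  rw [mul_smul, mul_smul, inv_smul_smul] at h1
  exact smul_left_cancel g h1

set_option synthInstance.maxHeartbeats 100000 in
omit [W.IsElliptic] [W.IsGloballyMinimal] in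
/-- **Transport of "`D` acts trivially on `E[p]/Φ`"** along `g • 𝔓 = 𝔓'`, for a rational line `Φ`.
[folklore] -/
theorem forall_decomposition_quot_of_smul_eq {𝔓 𝔓' : Ideal (absIntegers (𝓞 ℚ) ℚ)}
    {g : absoluteGaloisGroup ℚ} (hg : g • 𝔓 = 𝔓') {Φ : AddSubgroup (geomTorsion W (p : ℤ))}
    (hΦ : IsRationalLine W p Φ)
    (H : ∀ h ∈ 𝔓'.decompositionSubgroup (absoluteGaloisGroup ℚ), ∀ P : geomTorsion W (p : ℤ),
      h • P - P ∈ Φ) :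
    ∀ h ∈ 𝔓.decompositionSubgroup (absoluteGaloisGroup ℚ), ∀ P : geomTorsion W (p : ℤ),
      h • P - P ∈ Φ := by
  intro h hh P
  have h1 := H _ (conj_mem_decompositionSubgroup_of_smul_eq hg hh) (g • P)
  rw [mul_smul, mul_smul, inv_smul_smul, ← smul_sub] at h1
  have h2 := hΦ.2 g⁻¹ _ h1
  rwa [inv_smul_smul] at h2

set_option synthInstance.maxHeartbeats 100000 in
/-- **The dictionary at every prime above `p`.** For `W/ℚ` globally minimal elliptic, a good prime
`p > 2`, ANY prime `𝔓'` of `\bar ℤ` above `p` with decomposition group `D = D_{𝔓'}`, and a rational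
line `Φ ⊂ E[p]` (the kernel of a rational `p`-isogeny): `Anom W p` (`a_p ≡ 1 (mod p)`) iff `D` fixes
`Φ` pointwise ("`φ|_{G_p} = 1`") or acts trivially on `E[p]/Φ` ("`ψ|_{G_p} = 1`, i.e. `φ|_{G_p} = ω`").
Transported from the place's prime (`anom_iff_decomposition_of_good`) along a `g ∈ Γ_ℚ` with
`g • 𝔓 = 𝔓'` (`exists_smul_eq_of_mem_primesAbove_holds`). [cite: Serre1972, §1.11 Prop. 11–12]
[cite: CastellaGrossiSkinner2025, Thm. A (hypothesis on φ), §0 p. 3] -/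
theorem anom_iff_decomposition_of_mem_primesAbove (hp : 2 < p) (hgood : Good W p)
    {v : HeightOneSpectrum (𝓞 ℚ)} (hv : (primesEquiv v : ℕ) = p)
    {𝔓' : Ideal (absIntegers (𝓞 ℚ) ℚ)} (h𝔓' : 𝔓' ∈ v.primesAbove)
    {Φ : AddSubgroup (geomTorsion W (p : ℤ))} (hΦ : IsRationalLine W p Φ) :
    Anom W p ↔
      (∀ g ∈ 𝔓'.decompositionSubgroup (absoluteGaloisGroup ℚ), ∀ P ∈ Φ, g • P = P) ∨
      (∀ g ∈ 𝔓'.decompositionSubgroup (absoluteGaloisGroup ℚ), ∀ P : geomTorsion W (p : ℤ),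
        g • P - P ∈ Φ) := by
  obtain ⟨𝔓, hmem, h𝔓⟩ := exists_ideal_placeOver p hv
  obtain ⟨g, hg⟩ :=
    HeightOneSpectrum.exists_smul_eq_of_mem_primesAbove_holds (K := ℚ) (v := v) h𝔓 h𝔓'
  have hg' : g⁻¹ • 𝔓' = 𝔓 := by rw [← hg, inv_smul_smul]
  rw [anom_iff_decomposition_of_good hp hgood hmem hv h𝔓 hΦ]
  constructor
  · rintro (h | h)
    · exact Or.inl (forall_decomposition_fix_of_smul_eq hg' hΦ h)
    · exact Or.inr (forall_decomposition_quot_of_smul_eq hg' hΦ h)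
  · rintro (h | h)
    · exact Or.inl (forall_decomposition_fix_of_smul_eq hg hΦ h)
    · exact Or.inr (forall_decomposition_quot_of_smul_eq hg hΦ h)

/-- **Castella–Grossi–Skinner's hypothesis, literally, at any decomposition group at `p`:** for a
good prime `p > 2`, any prime `𝔓'` above `p` and the kernel `Φ` of a rational `p`-isogeny,
"`φ|_{G_p} ≠ 1, ω`" — `D_{𝔓'}` neither fixes `Φ` pointwise nor acts trivially on `E[p]/Φ` — iff
`¬ Anom W p`. [cite: CastellaGrossiSkinner2025, Thm. A (hypothesis on φ), §0 p. 3] -/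
theorem not_anom_iff_cgs_of_mem_primesAbove (hp : 2 < p) (hgood : Good W p)
    {v : HeightOneSpectrum (𝓞 ℚ)} (hv : (primesEquiv v : ℕ) = p)
    {𝔓' : Ideal (absIntegers (𝓞 ℚ) ℚ)} (h𝔓' : 𝔓' ∈ v.primesAbove)
    {Φ : AddSubgroup (geomTorsion W (p : ℤ))} (hΦ : IsRationalLine W p Φ) :
    ¬ Anom W p ↔
      (¬ ∀ g ∈ 𝔓'.decompositionSubgroup (absoluteGaloisGroup ℚ), ∀ P ∈ Φ, g • P = P) ∧
      (¬ ∀ g ∈ 𝔓'.decompositionSubgroup (absoluteGaloisGroup ℚ), ∀ P : geomTorsion W (p : ℤ),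
        g • P - P ∈ Φ) := by
  rw [anom_iff_decomposition_of_mem_primesAbove hp hgood hv h𝔓' hΦ, not_or]

/-- **CGS 2025 Thm. D with its printed hypothesis at any decomposition group at `p` ⇒ `BSD(E,p)`**
(`bsdp_of_thmD_of_cgs` transported): `W/ℚ` globally minimal elliptic with `ord_{s=1} L(E,s) ≤ 1`, a
good prime `p > 2`, the kernel `Φ` of a rational `p`-isogeny, a prime `𝔓'` above `p` whose
decomposition group neither fixes `Φ` nor acts trivially on `E[p]/Φ` ⇒ `BSDp W p` (from the named fact,
modularity, Gross–Zagier–Kolyvagin). [cite: CastellaGrossiSkinner2025, Theorem D and Thm. A (hypothesis on φ)] -/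
theorem bsdp_of_thmD_of_cgs_of_mem_primesAbove
    (hD : CastellaGrossiSkinner2025.thmD_padicValRat_bsd_rank_le_one)
    (hmod : hasEntireLFunction_rat) (hGZK : rank_eq_analyticRank_of_analyticRank_le_one)
    (hp : 2 < p) (hgood : Good W p)
    {v : HeightOneSpectrum (𝓞 ℚ)} (hv : (primesEquiv v : ℕ) = p)
    {𝔓' : Ideal (absIntegers (𝓞 ℚ) ℚ)} (h𝔓' : 𝔓' ∈ v.primesAbove)
    {Φ : AddSubgroup (geomTorsion W (p : ℤ))} (hΦ : IsRationalLine W p Φ)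
    (hφ1 : ¬ ∀ g ∈ 𝔓'.decompositionSubgroup (absoluteGaloisGroup ℚ), ∀ P ∈ Φ, g • P = P)
    (hφω : ¬ ∀ g ∈ 𝔓'.decompositionSubgroup (absoluteGaloisGroup ℚ), ∀ P : geomTorsion W (p : ℤ),
      g • P - P ∈ Φ)
    (hr : W.analyticRank ≤ 1) : BSDp W p := by
  have hred : Red W p := fun hirr ↦ by
    rcases hirr Φ hΦ.2 with h | h
    · have := hΦ.1; rw [h, AddSubgroup.card_bot] at this
      exact (Fact.out : p.Prime).one_lt.ne this
    · have h1 := hΦ.1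
      rw [h, AddSubgroup.card_top, natCard_geomTorsion W p] at h1
      have : p ^ 2 = p ^ 1 := by rw [pow_one]; exact h1
      exact absurd (Nat.pow_right_injective (Fact.out : p.Prime).two_le this) (by norm_num)
  exact bsdp_of_thmD_of_not_anom hD hmod hGZK W p hp hgood hred
    ((not_anom_iff_cgs_of_mem_primesAbove hp hgood hv h𝔓' hΦ).mpr ⟨hφ1, hφω⟩) hr

end Literature.NumberTheory.EllipticCurves.Rank1Residual

end
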